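import Summits.ResolutionOfSingularities.ResolutionOfSingularities.Theorems.FrobeniusClosingPatchingRelPerfectDepthHSepPeelMonomial
import HarnessLib

/-!
# `PatchingRelPerfect` (stmt-ResolutionOfSingularities-16161), chain W5.2 — rung R5ᴴ, N5: the PEEL LOOP of the H-side game

[OURS · L1 W5.2 · res-D-pv-016 AS res-L1-w52-stub-5, N5 (res-L1-w52-plan-1 NAMING G10-5 (1); OWNER res-D-pv-055, T-R5H
`…DepthTargetsR5H`).]  NOT statements of the manuscript under review; AI-written, weaker than expert review; FACT-FREE.

After N3 (CJS transport on the carrier) and N4 (END components regular) every member of the game's list is a MONOMIAL in ONE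
simple-normal-crossings family `𝓔` (no duplicates; non-unit members with preconnected support — e.g. the irreducible components
of `X_m ∪ B_m`).  N5 finishes the game from there by PEELS only: blow up a member `S₀ ∈ 𝓔` (the identity,
`DepthSep.isBlowup_id_of_mem`) that occurs in a charged member; by the PEEL LAW (`HSepPeel.colon_monoOf_eq_monoOf_peelExp`)
this is ONE legal `HSepSeq.cons` dividing the `S₀`-exponent of every member by one and appending `(S₀, w − 1)`
(`hSepSeq_peel`); the measure `μ = Σ_{charged q} a_q · deg q` drops (`HSepPeel.measure_peel_add` with `1 ≤ w ≤ Σ_{q ∋ S₀} a_q`),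
and `μ = 0` is `HSepEnd`.  Main theorems: `exists_hSepEnd_of_presentation` (from the end of any `HSepSeq` whose last state is
presented over `𝓔`), `exists_hSepEnd_of_monomial` (members given with monomial witnesses), `exists_hSepEnd_of_presentation_nil`.
[cite: Kollar2007, (3.111) Step 3] [cite: BierstoneGrigorievMilmanWlodarczyk2011, §4 Step 2b]
-/

-- `Summit.<Summit>.<Sub>.Theorems` with `Sub = Summit` (single-conjunct summit, D-0017)
set_option linter.dupNamespace false

noncomputable section

open CategoryTheory CategoryTheory.Limits AlgebraicGeometry TopologicalSpace IsLocalRing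
open Literature.AlgebraicGeometry.Resolution
open Scheme.IdealSheafData

namespace Summit.ResolutionOfSingularities.ResolutionOfSingularities.Theorems

universe u

namespace HSepPeel

open DepthTargets DepthSep

variable {W : Scheme.{u}}

/-! ## §1 The peel as ONE legal `HSepSeq` step -/

/-- **THE PEEL STEP**: blowing up a member `S₀` of the snc family (the identity) is a legal `HSepSeq.cons` whenever a charged
member contains `S₀`; the law divides the `S₀`-exponent of every member by one and appends `(S₀, w − 1)`.
[cite: Kollar2007, (3.111) Step 3] [cite: GortzWedhorn2020, (13.19)] -/
theorem hSepSeq_peel [IsLocallyNoetherian W] {𝓔 : List W.IdealSheafData} (h𝓔 : HasSNC 𝓔) (hnd : 𝓔.Nodup)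
    {S₀ : W.IdealSheafData} (hS₀ : S₀ ∈ 𝓔) (hS₀c : _root_.IsPreconnected (S₀.support : Set W))
    (P : List ((W.IdealSheafData → ℕ) × ℕ)) {W₀ : Scheme.{u}} {ρ : W ⟶ W₀} {𝒟₀ : List (W₀.IdealSheafData × ℕ)}
    (hseq : HSepSeq ρ 𝒟₀ (ofPres 𝓔 P))
    (hlegal : 1 ≤ weightOf (ofPres 𝓔 P) (divisorsOver (ofPres 𝓔 P) S₀ S₀.support)) :
    HSepSeq ρ 𝒟₀ (ofPres 𝓔 (P.map (fun q => (peelExp S₀ q.1, q.2)) ++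
      [(singleExp S₀, weightOf (ofPres 𝓔 P) (divisorsOver (ofPres 𝓔 P) S₀ S₀.support) - 1)])) := by
  have hreg : Scheme.IsRegular S₀.subscheme := (hasSNCWith_of_subset_of_mem h𝓔 (fun _ h => h) hS₀).isRegular_subscheme
  have h := HSepSeq.cons (𝟙 W) ρ 𝒟₀ (ofPres 𝓔 P) S₀ hseq hreg hS₀c hlegal (isBlowup_id_of_mem h𝓔 hS₀)
  rw [Category.id_comp] at h
  have hmap : (ofPres 𝓔 P).map (fun p => (controlledTransform (𝟙 W) S₀ p.1 1, p.2)) =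
      ofPres 𝓔 (P.map fun q => (peelExp S₀ q.1, q.2)) := by
    simp only [ofPres, List.map_map]
    refine List.map_congr_left fun q _ => ?_
    simp only [Function.comp_apply]
    rw [controlledTransform_id, colon_monoOf_eq_monoOf_peelExp h𝓔 hnd hS₀]
  have hexc : S₀.comap (𝟙 W) = monoOf 𝓔 (singleExp S₀) := by
    rw [Scheme.IdealSheafData.comap_id, monoOf_singleExp hnd hS₀]
  rw [hmap, hexc] at h
  rw [ofPres_append]
  simpa [ofPres] using h

/-! ## §2 The loop -/

/-- **THE PEEL LOOP** (strong induction on `μ`): from any presented state at the end of an `HSepSeq`, peels reach `HSepEnd`.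
[cite: Kollar2007, (3.111) Step 3] -/
theorem exists_hSepEnd_of_ofPres [IsLocallyNoetherian W] {𝓔 : List W.IdealSheafData} (h𝓔 : HasSNC 𝓔) (hnd : 𝓔.Nodup)
    (hconn : ∀ S ∈ 𝓔, S ≠ ⊤ → _root_.IsPreconnected (S.support : Set W)) :
    ∀ (n : ℕ) (P : List ((W.IdealSheafData → ℕ) × ℕ)), measure 𝓔 P ≤ n →
      ∀ {W₀ : Scheme.{u}} {ρ : W ⟶ W₀} {𝒟₀ : List (W₀.IdealSheafData × ℕ)}, HSepSeq ρ 𝒟₀ (ofPres 𝓔 P) →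
        ∃ 𝒟' : List (W.IdealSheafData × ℕ), HSepSeq ρ 𝒟₀ 𝒟' ∧ HSepEnd 𝒟' := by
  intro n
  induction n with
  | zero =>
    intro P hP W₀ ρ 𝒟₀ hseq
    exact ⟨_, hseq, hSepEnd_of_measure_eq_zero (Nat.le_zero.mp hP)⟩
  | succ n ih =>
    intro P hP W₀ ρ 𝒟₀ hseq
    by_cases h0 : measure 𝓔 P = 0
    · exact ⟨_, hseq, hSepEnd_of_measure_eq_zero h0⟩
    -- a charged member with a positive exponent on a non-unit member `S₀`
    obtain ⟨q, hq, hqz⟩ : ∃ q ∈ P, q.2 * degOf 𝓔 q.1 ≠ 0 := by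
      by_contra hall
      push Not at hall
      exact h0 (List.sum_eq_zero_iff.mpr fun x hx => by
        obtain ⟨q, hq, rfl⟩ := List.mem_map.mp hx; exact hall q hq)
    have ha : 1 ≤ q.2 := Nat.one_le_iff_ne_zero.mpr (fun h => hqz (by simp [h]))
    have hdeg : degOf 𝓔 q.1 ≠ 0 := fun h => hqz (by simp [h])
    classical
    obtain ⟨S₀, hS₀mem, hS₀e⟩ : ∃ S₀ ∈ 𝓔.toFinset.filter (fun S => S ≠ ⊤), q.1 S₀ ≠ 0 := by
      by_contra hall
      push Not at hall
      exact hdeg (Finset.sum_eq_zero_iff.mpr hall)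
    simp only [Finset.mem_filter, List.mem_toFinset] at hS₀mem
    obtain ⟨hS₀, hS₀t⟩ := hS₀mem
    have he : 1 ≤ q.1 S₀ := Nat.one_le_iff_ne_zero.mpr hS₀e
    have hne : (S₀.support : Set W).Nonempty := by
      rw [Set.nonempty_iff_ne_empty]
      intro h
      apply hS₀t
      rw [← Scheme.IdealSheafData.support_eq_bot_iff]
      exact TopologicalSpace.Closeds.ext h
    -- the peel is legal and lowers the measure
    have hlegal : 1 ≤ weightOf (ofPres 𝓔 P) (divisorsOver (ofPres 𝓔 P) S₀ S₀.support) := by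
      refine le_weightOf_ofPres _ P q hq ?_ |> le_trans ha
      rw [mem_divisorsOver_iff]
      exact ⟨List.mem_map.mpr ⟨(monoOf 𝓔 q.1, q.2), List.mem_map.mpr ⟨q, hq, rfl⟩, rfl⟩,
        fun x _ => stalkIdeal_mono (monoOf_le_of_one_le hS₀ he) x⟩
    have hwle : weightOf (ofPres 𝓔 P) (divisorsOver (ofPres 𝓔 P) S₀ S₀.support) ≤
        (P.map fun q => if 1 ≤ q.1 S₀ then q.2 else 0).sum :=
      weightOf_ofPres_le h𝓔 hS₀ hne _ (fun K hK x hx => ((mem_divisorsOver_iff).mp hK).2 x hx) P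
    have hstep := hSepSeq_peel h𝓔 hnd hS₀ (hconn S₀ hS₀ hS₀t) P hseq hlegal
    have hμ := measure_peel_add hS₀ hS₀t (weightOf (ofPres 𝓔 P) (divisorsOver (ofPres 𝓔 P) S₀ S₀.support) - 1) P
    refine ih _ ?_ hstep
    omega

/-- [OURS · L1 W5.2 · R5ᴴ N5] **THE PEEL LOOP OF THE H-SIDE GAME** (fact-free): on a locally Noetherian scheme `W`, given ONE
simple-normal-crossings family `𝓔` (no duplicates; non-unit members with connected support — e.g. the irreducible components of
`X_m ∪ B_m` after N3/N4) and a game state all of whose members are monomials over `𝓔` (presentation `P`: exponent function and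
charge per member), some sequence of PEELS (`HSepSeq` steps along members of `𝓔`, each the identity blowing up) reaches `HSepEnd`.
Consumed by res-D-pv-054's N4 / res-D-pv-055's N6 to finish `HSepGame₃`. [cite: Kollar2007, (3.111) Step 3]
[cite: BierstoneGrigorievMilmanWlodarczyk2011, §4 Step 2b] -/
theorem exists_hSepEnd_of_presentation [IsLocallyNoetherian W] {𝓔 : List W.IdealSheafData} (h𝓔 : HasSNC 𝓔)
    (hnd : 𝓔.Nodup) (hconn : ∀ S ∈ 𝓔, S ≠ ⊤ → _root_.IsPreconnected (S.support : Set W))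
    (P : List ((W.IdealSheafData → ℕ) × ℕ)) {W₀ : Scheme.{u}} {ρ : W ⟶ W₀} {𝒟₀ : List (W₀.IdealSheafData × ℕ)}
    (hseq : HSepSeq ρ 𝒟₀ (ofPres 𝓔 P)) :
    ∃ 𝒟' : List (W.IdealSheafData × ℕ), HSepSeq ρ 𝒟₀ 𝒟' ∧ HSepEnd 𝒟' :=
  exists_hSepEnd_of_ofPres h𝓔 hnd hconn (measure 𝓔 P) P le_rfl hseq

/-- The same from the START of a game whose members are monomials over `𝓔` (`HSepSeq.nil`). [cite: Kollar2007, (3.111) Step 3] -/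
theorem exists_hSepEnd_of_presentation_nil [IsLocallyNoetherian W] {𝓔 : List W.IdealSheafData}
    (h𝓔 : HasSNC 𝓔) (hnd : 𝓔.Nodup) (hconn : ∀ S ∈ 𝓔, S ≠ ⊤ → _root_.IsPreconnected (S.support : Set W))
    (P : List ((W.IdealSheafData → ℕ) × ℕ)) :
    ∃ 𝒟' : List (W.IdealSheafData × ℕ), HSepSeq (𝟙 W) (ofPres 𝓔 P) 𝒟' ∧ HSepEnd 𝒟' :=
  exists_hSepEnd_of_presentation h𝓔 hnd hconn P (HSepSeq.nil _)

/-- Presentations exist for lists of monomials over `𝓔`. [folklore] -/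
theorem exists_ofPres_eq {𝓔 : List W.IdealSheafData} :
    ∀ 𝒟 : List (W.IdealSheafData × ℕ), (∀ p ∈ 𝒟, ∃ e, p.1 = monoOf 𝓔 e) →
      ∃ P : List ((W.IdealSheafData → ℕ) × ℕ), ofPres 𝓔 P = 𝒟 := by
  intro 𝒟
  induction 𝒟 with
  | nil => exact fun _ => ⟨[], rfl⟩
  | cons p 𝒟 ih =>
    intro h
    obtain ⟨e, he⟩ := h p List.mem_cons_self
    obtain ⟨P, hP⟩ := ih fun q hq => h q (List.mem_cons_of_mem _ hq)
    refine ⟨(e, p.2) :: P, ?_⟩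
    show (monoOf 𝓔 e, p.2) :: ofPres 𝓔 P = p :: 𝒟
    rw [hP, ← he]

/-- [OURS · L1 W5.2 · R5ᴴ N5] **THE PEEL LOOP, members given with monomial witnesses**: if every member of the current state
`𝒟` of an `HSepSeq` is a monomial over ONE snc family `𝓔` (no duplicates, non-unit members with preconnected support), the game
reaches `HSepEnd` by peels. [cite: Kollar2007, (3.111) Step 3] -/
theorem exists_hSepEnd_of_monomial [IsLocallyNoetherian W] {𝓔 : List W.IdealSheafData} (h𝓔 : HasSNC 𝓔) (hnd : 𝓔.Nodup)
    (hconn : ∀ S ∈ 𝓔, S ≠ ⊤ → _root_.IsPreconnected (S.support : Set W)) {W₀ : Scheme.{u}} {ρ : W ⟶ W₀}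
    {𝒟₀ : List (W₀.IdealSheafData × ℕ)} {𝒟 : List (W.IdealSheafData × ℕ)} (hmono : ∀ p ∈ 𝒟, ∃ e, p.1 = monoOf 𝓔 e)
    (hseq : HSepSeq ρ 𝒟₀ 𝒟) : ∃ 𝒟' : List (W.IdealSheafData × ℕ), HSepSeq ρ 𝒟₀ 𝒟' ∧ HSepEnd 𝒟' := by
  obtain ⟨P, rfl⟩ := exists_ofPres_eq 𝒟 hmono
  exact exists_hSepEnd_of_presentation h𝓔 hnd hconn P hseq

/-- [OURS · L1 W5.2 · R5ᴴ N5 → N6] **THE PEEL LOOP in the shape N4/N6 consume** (res-D-pv-055 OWNER WORD 14:58:35Z, res-L1-w52-plan-1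
G11-4): witnesses UNFOLDED (`p.1 = monomialIdeal (𝓔.map fun S => (S, e S))`, N4's export) and the conclusion in the
`HSepGame₃` shape `∃ W' ρ' 𝒟', HSepSeq ρ' 𝒟₀ 𝒟' ∧ HSepEnd 𝒟'` (here `W' = W`, `ρ' = ρ`: peels are identity blow-ups).
[cite: Kollar2007, (3.111) Step 3] -/
theorem exists_hSepEnd_of_monomialIdeal [IsLocallyNoetherian W] {𝓔 : List W.IdealSheafData} (h𝓔 : HasSNC 𝓔)
    (hnd : 𝓔.Nodup) (hconn : ∀ S ∈ 𝓔, S ≠ ⊤ → _root_.IsPreconnected (S.support : Set W)) {W₀ : Scheme.{u}} {ρ : W ⟶ W₀}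
    {𝒟₀ : List (W₀.IdealSheafData × ℕ)} {𝒟 : List (W.IdealSheafData × ℕ)}
    (hmono : ∀ p ∈ 𝒟, ∃ e : W.IdealSheafData → ℕ, p.1 = monomialIdeal (𝓔.map fun S => (S, e S)))
    (hseq : HSepSeq ρ 𝒟₀ 𝒟) :
    ∃ (W' : Scheme.{u}) (ρ' : W' ⟶ W₀) (𝒟' : List (W'.IdealSheafData × ℕ)), HSepSeq ρ' 𝒟₀ 𝒟' ∧ HSepEnd 𝒟' :=
  ⟨W, ρ, exists_hSepEnd_of_monomial h𝓔 hnd hconn hmono hseq⟩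

end HSepPeel

end Summit.ResolutionOfSingularities.ResolutionOfSingularities.Theorems

end
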